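import Summits.FinalStateConjecture.FinalStateConjecture.Theorems.ZeroEnergyRigidity.Negative.KerrParameterSign
import Literature.Geometry.Lorentzian.KerrConvergence
import HarnessLib

/-!
# Stub `stub_spinReflection` of the line `frozen-charge-flat-modulus`
# (crux `BulkKerrCapture`, stmt-FinalStateConjecture-10696, route `PhaseMixingCapture`)

**Orientation blindness of `ConvergesToKerr`**: `Cᵏ` convergence to `g_{M,a}` in a region `𝒟`
(`Spacetime.ConvergesToKerr`, consequence form of `KerrConvergence.lean`) implies `Cᵏ` convergence
to `g_{M,−a}` in `𝒟`. The reflection `R(x⁰,x¹,x²,x³) = (x⁰,x¹,−x²,x³)` (`reflY` of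
`ZeroEnergyRigidity/Negative/KerrParameterSign.lean`, reused) is a linear isometric involution of
`E4` preserving `x⁰` with `g_{M,−a}(R x)(R v, R w) = g_{M,a}(x)(v, w)` (`bilin_neg_reflY`; Kerr,
PRL 11 (1963), eq. (5); Visser arXiv:0706.0622, (32)–(35)); so a late-time embedding `Ψ` modelled
on `Kerr.background M a` gives `Ψ ∘ R̃` modelled on `Kerr.background M (−a)` (`R̃ = R` between the
exteriors, the term `Subtype.map reflY _`) with the same image sets and the extended deviation
`L ∘ (Ψ^* g − g_{M,a}) ∘ R`, `L B = B(R ·, R ·)` a linear isometry of the bilinear forms, whence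
equal `Cᵏ` slab norms (`LinearIsometryEquiv.norm_iteratedFDeriv_comp_left/right`). No new
definitions; plumbing in `…Theorems.StubSpinReflection`, the registered stub is
`stub_spinReflection`.
-/

-- the doubled `FinalStateConjecture.FinalStateConjecture` path component trips dupNamespace
set_option linter.dupNamespace false

noncomputable section

open Set Filter Function TopologicalSpace Topology Literature.Geometry.Lorentzian
open scoped Manifold ContDiff ENNReal Topology

namespace Summit.FinalStateConjecture.FinalStateConjecture.Theorems
namespace StubSpinReflection

open ZeroEnergyRigidity.Negative

/-! ### Norms of iterated derivatives under isometric linear changes of variable and of value -/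

section Isometry

variable {E W : Type*} [NormedAddCommGroup E] [NormedSpace ℝ E] [NormedAddCommGroup W]
  [NormedSpace ℝ W]

/-- `‖Dᵐ(L ∘ f)(x)‖ = ‖Dᵐ f(x)‖` for a surjective norm-preserving linear map `L` of the target
(`LinearIsometryEquiv.norm_iteratedFDeriv_comp_left`, unbundled: `L` is a bare function). -/
theorem norm_iteratedFDeriv_comp_left_eq {L : W → W} (hadd : ∀ v w, L (v + w) = L v + L w)
    (hsmul : ∀ (c : ℝ) v, L (c • v) = c • L v) (hnorm : ∀ v, ‖L v‖ = ‖v‖)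
    (hsurj : Surjective L) (f : E → W) (x : E) (m : ℕ) :
    ‖iteratedFDeriv ℝ m (L ∘ f) x‖ = ‖iteratedFDeriv ℝ m f x‖ :=
  (LinearIsometryEquiv.ofSurjective
    { toFun := L, map_add' := hadd, map_smul' := hsmul, norm_map' := hnorm }
    hsurj).norm_iteratedFDeriv_comp_left f x m

/-- `‖Dᵐ(f ∘ R)(x)‖ = ‖Dᵐ f(R x)‖` for a surjective norm-preserving linear map `R` of the source
(`LinearIsometryEquiv.norm_iteratedFDeriv_comp_right`, unbundled). -/
theorem norm_iteratedFDeriv_comp_right_eq {R : E → E} (hadd : ∀ v w, R (v + w) = R v + R w)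
    (hsmul : ∀ (c : ℝ) v, R (c • v) = c • R v) (hnorm : ∀ v, ‖R v‖ = ‖v‖)
    (hsurj : Surjective R) (f : E → W) (x : E) (m : ℕ) :
    ‖iteratedFDeriv ℝ m (f ∘ R) x‖ = ‖iteratedFDeriv ℝ m f (R x)‖ :=
  (LinearIsometryEquiv.ofSurjective
    { toFun := R, map_add' := hadd, map_smul' := hsmul, norm_map' := hnorm }
    hsurj).norm_iteratedFDeriv_comp_right f x m

end Isometry

/-! ### The reflection `R = reflY` : norm, surjectivity, and `L B = B(R ·, R ·)` -/

/-- `R` preserves the Euclidean norm of `E4`. -/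
theorem norm_reflY (x : E4) : ‖reflY x‖ = ‖x‖ := by
  rw [EuclideanSpace.norm_eq, EuclideanSpace.norm_eq]
  simp [Fin.sum_univ_four]

/-- `R` is surjective (an involution). -/
theorem reflY_surjective : Surjective (reflY : E4 → E4) := fun x ↦ ⟨reflY x, reflY_reflY x⟩

/-- `‖B(R ·, R ·)‖ ≤ ‖B‖` for the operator norm of bilinear forms. -/
theorem norm_bilinearComp_reflY_le (B : E4 →L[ℝ] E4 →L[ℝ] ℝ) :
    ‖B.bilinearComp reflY reflY‖ ≤ ‖B‖ := by
  refine ContinuousLinearMap.opNorm_le_bound₂ _ (norm_nonneg B) fun v w ↦ ?_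
  rw [ContinuousLinearMap.bilinearComp_apply]
  have h := B.le_opNorm₂ (reflY v) (reflY w)
  rwa [norm_reflY, norm_reflY] at h

/-- `B(R R ·, R R ·) = B`. -/
@[simp] theorem bilinearComp_reflY_reflY (B : E4 →L[ℝ] E4 →L[ℝ] ℝ) :
    (B.bilinearComp reflY reflY).bilinearComp reflY reflY = B := by
  ext v w; simp [reflY_reflY]

/-- `L B = B(R ·, R ·)` preserves the operator norm. -/
theorem norm_bilinearComp_reflY (B : E4 →L[ℝ] E4 →L[ℝ] ℝ) : ‖B.bilinearComp reflY reflY‖ = ‖B‖ :=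
  le_antisymm (norm_bilinearComp_reflY_le B) <| by
    simpa only [bilinearComp_reflY_reflY] using
      norm_bilinearComp_reflY_le (B.bilinearComp reflY reflY)

/-- **`‖Dᵐ(L ∘ F ∘ R)(y)‖ = ‖Dᵐ F(R y)‖`** for `L B = B(R ·, R ·)` and any
`F : E4 → (E4 →L E4 →L ℝ)`: both `L` and `R` are surjective linear isometries. -/
theorem norm_iteratedFDeriv_conj_reflY (F : E4 → E4 →L[ℝ] E4 →L[ℝ] ℝ) (y : E4) (m : ℕ) :
    ‖iteratedFDeriv ℝ m
        ((fun B : E4 →L[ℝ] E4 →L[ℝ] ℝ ↦ B.bilinearComp reflY reflY) ∘ (F ∘ reflY)) y‖ =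
      ‖iteratedFDeriv ℝ m F (reflY y)‖ := by
  rw [norm_iteratedFDeriv_comp_left_eq (fun B B' ↦ by ext v w; simp) (fun c B ↦ by ext v w; simp)
      norm_bilinearComp_reflY (fun B ↦ ⟨B.bilinearComp reflY reflY, bilinearComp_reflY_reflY B⟩),
    norm_iteratedFDeriv_comp_right_eq reflY.map_add reflY.map_smul norm_reflY reflY_surjective]

/-! ### The reflected chart domain `R̃ : exterior(M, −a) → exterior(M, a)` -/

variable (M a : ℝ)

/-- `R` maps `exterior(M, −a)` into `exterior(M, a)` (domains of the Kerr backgrounds). -/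
theorem mapsTo_reflY :
    ∀ x, x ∈ (Kerr.background M (-a)).domain → reflY x ∈ (Kerr.background M a).domain :=
  fun _ hx ↦ reflY_mem_exterior hx

/-- `R` maps `exterior(M, a)` into `exterior(M, −a)`. -/
theorem mapsTo_reflY_inv :
    ∀ x, x ∈ (Kerr.background M a).domain → reflY x ∈ (Kerr.background M (-a)).domain := by
  intro x hx
  have h := mapsTo_reflY M (-a) x
  rw [neg_neg] at h
  exact h hx

-- Below, the reflected chart domain `R̃ : exterior(M, −a) → exterior(M, a)`, `x ↦ R x`, is the
-- term `Subtype.map reflY (mapsTo_reflY M a)`, and its inverse is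
-- `Subtype.map reflY (mapsTo_reflY_inv M a)` (no new definitions are introduced).

/-- `R̃ (R̃⁻¹ x) = x`. -/
theorem reflMap_reflMapInv (x : (Kerr.background M a).domain) :
    Subtype.map reflY (mapsTo_reflY M a) (Subtype.map reflY (mapsTo_reflY_inv M a) x) = x :=
  Subtype.ext (reflY_reflY _)

/-- `R̃⁻¹ (R̃ x) = x`. -/
theorem reflMapInv_reflMap (x : (Kerr.background M (-a)).domain) :
    Subtype.map reflY (mapsTo_reflY_inv M a) (Subtype.map reflY (mapsTo_reflY M a) x) = x :=
  Subtype.ext (reflY_reflY _)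

/-- `R̃` is smooth (its composite with the inclusion into `E4` is `R` restricted to an open set). -/
theorem contMDiff_reflMap :
    ContMDiff 𝓘(ℝ, E4) 𝓘(ℝ, E4) ∞ (Subtype.map reflY (mapsTo_reflY M a)) := by
  rw [← ContMDiff.subtypeVal_comp_iff]
  exact reflY.contMDiff.comp contMDiff_subtype_val

/-- **The differential of `R̃` is `R`** (charts of open submanifolds of `E4` are restrictions of the
identity: `OpensChart.mfderiv_codRestrict`, `OpensChart.mfderiv_eq`; as `mfderiv_reflExt`). -/
theorem mfderiv_reflMap (x : (Kerr.background M (-a)).domain) :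
    mfderiv 𝓘(ℝ, E4) 𝓘(ℝ, E4) (Subtype.map reflY (mapsTo_reflY M a)) x = reflY := by
  have hf : ∀ y : (Kerr.background M (-a)).domain,
      (fun y : (Kerr.background M (-a)).domain ↦ reflY y.1) y = reflY y.1 := fun _ ↦ rfl
  have hd : MDifferentiableAt 𝓘(ℝ, E4) 𝓘(ℝ, E4)
      (fun y : (Kerr.background M (-a)).domain ↦ reflY y.1) x :=
    (OpensChart.mdifferentiableAt_iff x _ reflY hf).2 reflY.differentiableAt
  rw [OpensChart.mfderiv_codRestrict (φ := Subtype.map reflY (mapsTo_reflY M a))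
    (f := fun y : (Kerr.background M (-a)).domain ↦ reflY y.1) (fun _ ↦ rfl) hd,
    OpensChart.mfderiv_eq x _ reflY hf reflY.differentiableAt, ContinuousLinearMap.fderiv]

/-- **Chain rule for the reflected chart**: `d(Ψ ∘ R̃)_x v = dΨ_{R̃ x} (R v)`. -/
theorem mfderiv_comp_reflMap {N : Type*} [TopologicalSpace N]
    [ChartedSpace (EuclideanSpace ℝ (Fin 4)) N] {Ψ : (Kerr.background M a).domain → N}
    (hΨ : ContMDiff 𝓘(ℝ, E4) (𝓡 4) ∞ Ψ) (x : (Kerr.background M (-a)).domain) (v : E4) :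
    mfderiv 𝓘(ℝ, E4) (𝓡 4) (Ψ ∘ Subtype.map reflY (mapsTo_reflY M a)) x v =
      mfderiv 𝓘(ℝ, E4) (𝓡 4) Ψ (Subtype.map reflY (mapsTo_reflY M a) x) (reflY v) := by
  rw [mfderiv_comp x (hΨ.mdifferentiableAt (by simp))
    ((contMDiff_reflMap M a).mdifferentiableAt (by simp)), mfderiv_reflMap]
  rfl

/-! ### Late regions, slabs and image sets -/

/-- **The restriction of `Ψ ∘ R̃` to the late region `{t* > τ₀}` is an open embedding if that of
`Ψ` is**: it is the latter composed with the bijection of late regions induced by `R̃` (continuous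
with continuous inverse induced by `R̃⁻¹`, as `R` preserves `t* = x⁰`). -/
theorem isOpenEmbedding_restrict_comp_reflMap {N : Type*} [TopologicalSpace N] (τ₀ : ℝ)
    {Ψ : (Kerr.background M a).domain → N}
    (hΨ : IsOpenEmbedding (((Kerr.background M a).lateRegion τ₀).restrict Ψ)) :
    IsOpenEmbedding (((Kerr.background M (-a)).lateRegion τ₀).restrict
      (Ψ ∘ Subtype.map reflY (mapsTo_reflY M a))) := by
  have h₁ : ∀ z : (Kerr.background M (-a)).domain, z ∈ (Kerr.background M (-a)).lateRegion τ₀ →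
      Subtype.map reflY (mapsTo_reflY M a) z ∈ (Kerr.background M a).lateRegion τ₀ :=
    fun z hz ↦ lt_of_lt_of_eq (show τ₀ < (z : E4) 0 from hz) (reflY_apply_zero _).symm
  have h₂ : ∀ w : (Kerr.background M a).domain, w ∈ (Kerr.background M a).lateRegion τ₀ →
      Subtype.map reflY (mapsTo_reflY_inv M a) w ∈ (Kerr.background M (-a)).lateRegion τ₀ :=
    fun w hw ↦ lt_of_lt_of_eq (show τ₀ < (w : E4) 0 from hw) (reflY_apply_zero _).symm
  have hl : LeftInverse (Subtype.map _ h₁) (Subtype.map _ h₂) :=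
    fun w ↦ Subtype.ext (reflMap_reflMapInv M a w.1)
  have hr : RightInverse (Subtype.map _ h₁) (Subtype.map _ h₂) :=
    fun z ↦ Subtype.ext (reflMapInv_reflMap M a z.1)
  exact hΨ.comp (.of_continuous_injective_isOpenMap
    ((contMDiff_reflMap M a).continuous.subtype_map h₁) hr.injective
    (IsOpenMap.of_inverse ((reflY.continuous.subtype_map (mapsTo_reflY_inv M a)).subtype_map h₂)
      hl hr))

/-- `R̃` maps `{x | p(x⁰)} ∩ exterior(−a)` onto `{x | p(x⁰)} ∩ exterior(a)` (it preserves `x⁰`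
and is invertible); `p = (τ₀ < ·)` gives the late regions, `p = (· = τ)` the slabs. -/
theorem image_reflMap_setOf (p : ℝ → Prop) :
    Subtype.map reflY (mapsTo_reflY M a) '' {x : (Kerr.background M (-a)).domain | p ((x : E4) 0)} =
      {x : (Kerr.background M a).domain | p ((x : E4) 0)} := by
  ext w
  simp only [Set.mem_image, Set.mem_setOf_eq]
  constructor
  · rintro ⟨z, hz, rfl⟩
    show p (reflY (z : E4) 0)
    rwa [reflY_apply_zero]
  · intro hw
    exact ⟨Subtype.map reflY (mapsTo_reflY_inv M a) w,
      show p (reflY (w : E4) 0) by rwa [reflY_apply_zero], reflMap_reflMapInv M a w⟩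

/-- Image sets of the late region agree: `(Ψ ∘ R̃)({t* > τ₀}) = Ψ({t* > τ₀})`. -/
theorem image_comp_lateRegion {N : Type*} (τ₀ : ℝ) (Ψ : (Kerr.background M a).domain → N) :
    (Ψ ∘ Subtype.map reflY (mapsTo_reflY M a)) '' (Kerr.background M (-a)).lateRegion τ₀ =
      Ψ '' (Kerr.background M a).lateRegion τ₀ :=
  (Set.image_comp Ψ _ _).trans (congrArg (Ψ '' ·) (image_reflMap_setOf M a (τ₀ < ·)))

/-- Image sets of the slabs agree: `(Ψ ∘ R̃)({t* = τ}) = Ψ({t* = τ})`. -/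
theorem image_comp_timeSlab {N : Type*} (τ : ℝ) (Ψ : (Kerr.background M a).domain → N) :
    (Ψ ∘ Subtype.map reflY (mapsTo_reflY M a)) '' (Kerr.background M (-a)).timeSlab τ =
      Ψ '' (Kerr.background M a).timeSlab τ :=
  (Set.image_comp Ψ _ _).trans (congrArg (Ψ '' ·) (image_reflMap_setOf M a (· = τ)))

/-- The coordinate slab `{y ∈ exterior(a) | y⁰ = τ} ⊆ E4` is the `R`-image of that of
`exterior(−a)`. -/
theorem val_image_timeSlab_eq (τ : ℝ) :
    Subtype.val '' (Kerr.background M a).timeSlab τ =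
      reflY '' (Subtype.val '' (Kerr.background M (-a)).timeSlab τ) := by
  rw [← image_comp_timeSlab M a τ Subtype.val, Set.image_image]
  rfl

/-! ### The deviation of the reflected chart -/

variable {𝓢 : Spacetime 4}

/-- On the domain the extended deviation is the deviation (`deviationExtend_coe` at `⟨y, hy⟩`). -/
theorem deviationExtend_apply_mem (B : ModelBackground) (Ψ : B.domain → 𝓢.carrier) {y : E4}
    (hy : y ∈ B.domain) : 𝓢.deviationExtend B Ψ y = 𝓢.deviation B Ψ ⟨y, hy⟩ :=
  𝓢.deviationExtend_coe B Ψ ⟨y, hy⟩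

/-- `g_{M,−a}(x)(v, w) = g_{M,a}(R x)(R v, R w)` (`bilin_neg_reflY` at `R x`, `R` an involution). -/
theorem kerr_bilin_neg (x v w : E4) :
    Kerr.bilin M (-a) x v w = Kerr.bilin M a (reflY x) (reflY v) (reflY w) := by
  rw [← bilin_neg_reflY M a (reflY x) (reflY v) (reflY w), reflY_reflY, reflY_reflY, reflY_reflY]

/-- **Pointwise reflection identity**:
`((Ψ ∘ R̃)^* g − g_{M,−a})(x)(v, w) = (Ψ^* g − g_{M,a})(R̃ x)(R v, R w)` (chain rule
`d(Ψ ∘ R̃) = dΨ ∘ R` and `g_{M,−a}(x)(v, w) = g_{M,a}(R x)(R v, R w)`). -/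
theorem deviation_reflect {Ψ : (Kerr.background M a).domain → 𝓢.carrier}
    (hΨ : ContMDiff 𝓘(ℝ, E4) (𝓡 4) ∞ Ψ) (x : (Kerr.background M (-a)).domain) (v w : E4) :
    𝓢.deviation (Kerr.background M (-a)) (Ψ ∘ Subtype.map reflY (mapsTo_reflY M a)) x v w =
      𝓢.deviation (Kerr.background M a) Ψ (Subtype.map reflY (mapsTo_reflY M a) x) (reflY v)
        (reflY w) := by
  rw [Spacetime.deviation_apply, Spacetime.deviation_apply, mfderiv_comp_reflMap M a hΨ,
    mfderiv_comp_reflMap M a hΨ]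
  exact congrArg₂ (· - ·) rfl (kerr_bilin_neg M a x v w)

/-- **The extended deviations are conjugate**: `D' = L ∘ D ∘ R` on all of `E4` (`D`, `D'` the
deviations of `Ψ`, `Ψ ∘ R̃` extended by zero; off the exteriors both sides are `0 = L 0`). -/
theorem deviationExtend_reflect {Ψ : (Kerr.background M a).domain → 𝓢.carrier}
    (hΨ : ContMDiff 𝓘(ℝ, E4) (𝓡 4) ∞ Ψ) :
    𝓢.deviationExtend (Kerr.background M (-a)) (Ψ ∘ Subtype.map reflY (mapsTo_reflY M a)) =
      (fun B : E4 →L[ℝ] E4 →L[ℝ] ℝ ↦ B.bilinearComp reflY reflY) ∘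
        (𝓢.deviationExtend (Kerr.background M a) Ψ ∘ reflY) := by
  funext y
  simp only [Function.comp_apply]
  by_cases hy : y ∈ (Kerr.background M (-a)).domain
  · rw [deviationExtend_apply_mem (Kerr.background M (-a)) _ hy,
      deviationExtend_apply_mem (Kerr.background M a) _ (mapsTo_reflY M a y hy)]
    ext v w
    rw [ContinuousLinearMap.bilinearComp_apply, deviation_reflect M a hΨ ⟨y, hy⟩ v w]
    rfl
  · have hy' : reflY y ∉ (Kerr.background M a).domain := fun h ↦ hy <| by
      simpa only [reflY_reflY] using mapsTo_reflY_inv M a _ h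
    rw [𝓢.deviationExtend_of_not_mem (Kerr.background M (-a)) _ hy,
      𝓢.deviationExtend_of_not_mem (Kerr.background M a) _ hy',
      ContinuousLinearMap.bilinearComp_zero]

/-- **The `Cᵏ` deviations on the slabs agree**: `deviationCk` of `Ψ ∘ R̃` from `g_{M,−a}` equals
`deviationCk` of `Ψ` from `g_{M,a}`, slab by slab (`‖Dᵐ(L ∘ D ∘ R)(y)‖ = ‖Dᵐ D(R y)‖` since
`L`, `R` are linear isometric bijections, and `R` bijects the coordinate slabs). -/
theorem deviationCk_reflect {Ψ : (Kerr.background M a).domain → 𝓢.carrier}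
    (hΨ : ContMDiff 𝓘(ℝ, E4) (𝓡 4) ∞ Ψ) (k : ℕ) (τ : ℝ) :
    𝓢.deviationCk (Kerr.background M (-a)) (Ψ ∘ Subtype.map reflY (mapsTo_reflY M a)) k τ =
      𝓢.deviationCk (Kerr.background M a) Ψ k τ := by
  unfold Spacetime.deviationCk supCkENorm
  rw [val_image_timeSlab_eq M a τ]
  simp_rw [iSup_image]
  refine iSup_congr fun m ↦ iSup_congr fun _ ↦ iSup_congr fun y ↦ iSup_congr fun _ ↦ ?_
  rw [enorm_eq_iff_norm_eq, deviationExtend_reflect M a hΨ, norm_iteratedFDeriv_conj_reflY]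

/-- **Late-time embeddings reflect**: if `Ψ` is a late-time embedding for `𝒟` modelled on
`Kerr.background M a` after `τ₀`, then `Ψ ∘ R̃` is one modelled on `Kerr.background M (−a)`
(smoothness and open embeddings compose with `R̃`; the image sets are unchanged). -/
theorem isLateEmbedding_reflect {𝒟 : Set 𝓢.carrier} {τ₀ : ℝ}
    {Ψ : (Kerr.background M a).domain → 𝓢.carrier}
    (hΨ : 𝓢.IsLateEmbedding (Kerr.background M a) 𝒟 τ₀ Ψ) :
    𝓢.IsLateEmbedding (Kerr.background M (-a)) 𝒟 τ₀ (Ψ ∘ Subtype.map reflY (mapsTo_reflY M a)) where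
  contMDiff := hΨ.contMDiff.comp (contMDiff_reflMap M a)
  isOpenEmbedding := isOpenEmbedding_restrict_comp_reflMap M a τ₀ hΨ.isOpenEmbedding
  image_subset := by
    rw [image_comp_lateRegion]
    exact hΨ.image_subset
  diff_subset_causalPast := by
    rw [image_comp_lateRegion, image_comp_timeSlab]
    exact hΨ.diff_subset_causalPast

/-- **Convergence to `g_{M,a}` implies convergence to `g_{M,−a}`**, in the reflected chart, for any
spacetime (universe-polymorphic form of the stub). -/
theorem convergesToKerr_neg {𝒟 : Set 𝓢.carrier} {k : ℕ} (h : 𝓢.ConvergesToKerr 𝒟 M a k) :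
    𝓢.ConvergesToKerr 𝒟 M (-a) k := by
  obtain ⟨τ₀, Ψ, hΨ, hlim⟩ := h
  refine ⟨τ₀, Ψ ∘ Subtype.map reflY (mapsTo_reflY M a), isLateEmbedding_reflect M a hΨ, ?_⟩
  rw [show 𝓢.deviationCk (Kerr.background M (-a)) (Ψ ∘ Subtype.map reflY (mapsTo_reflY M a)) k =
    𝓢.deviationCk (Kerr.background M a) Ψ k from funext (deviationCk_reflect M a hΨ.contMDiff k)]
  exact hlim

end StubSpinReflection

/-- **Stub `stub_spinReflection` (S4) of the line `frozen-charge-flat-modulus` (crux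
`BulkKerrCapture`): orientation blindness of `ConvergesToKerr`.** If a spacetime converges in
`Cᵏ` to the Kerr metric `g_{M,a}` in a region `𝒟` (Kerr–Schild pullback gauge,
`Spacetime.ConvergesToKerr`), then it converges in `Cᵏ` to `g_{M,−a}` in the same region: the
reflection `R(x⁰,x¹,x²,x³) = (x⁰,x¹,−x²,x³)` is a linear isometry of `E4` with
`R^* g_{M,−a} = g_{M,a}` on the common exterior `{r > max r₊ 0}` (Kerr 1963, eq. (5); Visser
arXiv:0706.0622, (32)–(35)), so a late-time embedding `Ψ` modelled on `g_{M,a}` gives the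
late-time embedding `Ψ ∘ R̃` modelled on `g_{M,−a}` with the same image sets and the same `Cᵏ`
slab deviations (`StubSpinReflection.convergesToKerr_neg`). [folklore] -/
theorem stub_spinReflection :
    ∀ (𝓢 : Spacetime.{0} 4) (𝒟 : Set 𝓢.carrier) (M a : ℝ) (k : ℕ),
      𝓢.ConvergesToKerr 𝒟 M a k → 𝓢.ConvergesToKerr 𝒟 M (-a) k :=
  fun _ _ M a _ h ↦ StubSpinReflection.convergesToKerr_neg M a h

end Summit.FinalStateConjecture.FinalStateConjecture.Theorems

end
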